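import Summits.BirchSwinnertonDyer.BirchSwinnertonDyer.Theses.KolyvaginRoadThree
import Summits.BirchSwinnertonDyer.BirchSwinnertonDyer.Theorems.KolyvaginRoadThreeKernelHL
import Summits.BirchSwinnertonDyer.BirchSwinnertonDyer.Theorems.KolyvaginRoadThreeLevelData
import Summits.BirchSwinnertonDyer.Rank1Residual.X11b.Three.OpenInputTightFacts
import Summits.BirchSwinnertonDyer.Rank1Residual.X11b.Three.OpenInputTightLocus
import Literature.NumberTheory.EllipticCurves.HeegnerPointsOfConductorOneGaloisConjProofs
import Literature.NumberTheory.GaloisRepresentations.NumberFieldCdTwoProofs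
import Literature.NumberTheory.EllipticCurves.HeegnerPointsOfConductorRationalityProofs
import Literature.NumberTheory.EllipticCurves.RingClassGalOverCyclicProofs
import Literature.NumberTheory.EllipticCurves.Rank1Residual.Typed.X11Three
import Literature.NumberTheory.EllipticCurves.Rank1Residual.ClassX1KellerYinCertificate
import HarnessLib

/-!
# Route `KolyvaginRoadThree` (rung K2 at `p = 3`), deciding crux `ZhangSharpFrameAtThreeHL`
# (item stmt-BirchSwinnertonDyer-19574): what the crux delivers IN THE OTHER CURRENCIES at `3` —
# Castella's Thm. A′ read at `p = 3` (`X11Three.MissingInputAt`) on the Tamagawa-unit locus, and THE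
# open input `P2OpenInputOnTreeOddAt W 3` on A1 ∩ locally-trivial — BY NAME
# (cell `bsd-stepL`, seat `bsd-stepL-mult-p3`, session g0; `--supports stmt-BirchSwinnertonDyer-19574`)

HONEST FRAMING (cell `bsd-stepL`, HOME `run/shared/lean/pub/bsd-stepL/`): by-name compositions of landed
kernel theorems; nothing here proves the crux, the missing input or the open input; item 19574 is NOT
closed; nothing is booked or re-labelled (T7); BSD is proved for no curve. Every theorem is CONDITIONAL
on the binders in its signature (published named facts as hypotheses; the crux
`Summit.….Theses.KolyvaginRoadThree.ZhangSharpFrameAtThreeHL` = Kolyvagin's conjecture mod `3` at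
`3 ∥ N` on Hoffstein–Luo frames — Skinner–Zhang ∕ W. Zhang indivisibility RUN AT `p = 3`, the cell's memo
theorem Z₃♯, OPEN in the kernel).

WHAT THIS FILE RECORDS. The two typed currencies of the `p = 3` cell O2 other than `BSDp W 3` are
(a) the census cell's `X11Three.MissingInputAt W` := `X11.AprimeLocusAt W 3 → PPart W 3` — "Castella's
erratum Thm. A′ with `p > 3` read as `p = 3`" (`Rank1Residual/Typed/X11Three.lean`; no source, no
announcement at `3`), and (b) route p2's THE open input `X11b.P2OpenInputOnTreeOddAt W 3` (the
(IMC≥)∘(BDP) inequality at `𝟙` on every odd Heegner datum; K2@3's H-currency). On the Kolyvagin road: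
* §1 `kolyvaginRoadThree_x11ThreeMissingInputAt_onTam_of_zhangSharpFrameAtThreeHL` — the crux ⟹
  `X11Three.MissingInputAt W` for EVERY `(E,3) ∈` X11b with `3 ∤ ∏_ℓ c_ℓ(E)` (the A′-locus antecedent of
  the missing input supplies the (ram) witness, so the atom reached is A1 = (ram) ∧ `3 ∤ ∏c`, 1 116
  TRUE-OPEN classes, cw 248 943; Thm. A′'s OTHER two side conditions — NON-split witness, `E(ℚ_3)[3] = 0`
  — are not used: the Kolyvagin road needs neither), via §0 (the HL kernel with seam G-a
  discharged by two Literature theorems) and the rank-`≤ 1` print shape `pPart_of_bsdp`.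
* §2 `kolyvaginRoadThree_openInputOnTreeOddAt_three_of_zhangSharpFrameAtThreeHL` — the crux ⟹ THE open
  input `P2OpenInputOnTreeOddAt W 3` on A1 ∩ `LocallyTrivialAt W 3` (every bad `ℓ ≠ 3`: `E(ℚ_ℓ)[3] = 0`,
  `3 ∤ c_ℓ`), via x11b3's tightness theorem with the control identity DISCHARGED there
  (`P2.openInputOnTreeOddAt_of_bsdp_of_locallyTrivial`, Poitou–Tate ×2 + local Euler characteristic +
  `cd ≤ 2` cited); off `LocallyTrivialAt` the control identity's ≥ half (route R1 atom (P11)) is not a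
  tree theorem, so no claim is made there.
So, BY NAME: Skinner–Zhang indivisibility at `3` (the KOLY crux) ⟹ the census's missing input at `3` on
the Tamagawa-unit locus, and ⟹ K2@3's open input on A1 ∩ locally-trivial — the sentence «the missing
input at 3 attacked via Skinner–Zhang indivisibility» made a kernel implication with its exact locus.

ADDENDUM (session g2, §3–§4). The restriction to `LocallyTrivialAt W 3` in §2 is NOT needed: x11b3's
`Three/ControlIdentityLocus` ∕ `Three/OpenInputTightLocus` (2026-08-21) prove the control identity at every
odd `p` on the WHOLE Locus X11b ∧ (ram) ∧ `p ∤ ∏c` from Kolyvagin + the cited cohomological facts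
(`P2.openInputOnTreeOddAt_of_bsdp_of_locus_of_facts`). §3 records the crux ⟹ THE open input
`P2OpenInputOnTreeOddAt W 3` on ALL of A1 (1 116 TRUE-OPEN classes, cw 248 943), and ⟹ x11b3-p1's typed
STEP-L-at-3 conjecture `Three.StepLAt W` there; §4 re-issues §0 with the Shimura-reciprocity binder `hrec`
DISCHARGED by the tree theorem `heegnerPointOfConductor_one_galoisConj_holds` (and §3 with `hcd`
discharged by `fieldCdLE_two_of_numberField_holds`). So the sentence «the missing input at 3 via
Skinner–Zhang indivisibility» is a kernel implication on the whole atom A1, resting on the crux + published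
named facts + three cited cohomological facts (`hEP`, `hPTs`, `hPT2`) only.

References: [WZhang2014] Thm. 1.1; [SkinnerZhang2014] Thm. 1.3; [McCallumLMS1991] Cor. 5.6;
[Castella2018Erratum] Thm. A′ (shape at 3); [Castella2018] Thms. 2.3, 3.2; [JetchevSkinnerWan2017]
Thm. 3.3.1, §7.4.1; [Skinner2016PacificMC] Thm. C; [Miller2011LMS] Def. 1.1.
-/

set_option autoImplicit false

noncomputable section

open scoped Classical NumberField

namespace Summit.BirchSwinnertonDyer.Rank1Residual.X11b.Three.Koly

open WeierstrassCurve NumberField IsDedekindDomain Field Literature.NumberTheory.EllipticCurves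
  Literature.NumberTheory.EllipticCurves.ModularForms
  Literature.NumberTheory.EllipticCurves.Rank1Residual
  Literature.NumberTheory.EllipticCurves.Rank1Residual.Typed
  Literature.NumberTheory.GaloisRepresentations Literature.NumberTheory.GaloisCohomology
  Summit.BirchSwinnertonDyer.Rank1Residual Summit.BirchSwinnertonDyer.Rank1Residual.X11b
  Summit.BirchSwinnertonDyer.BirchSwinnertonDyer.Theses.KolyvaginRoadThree

/-! ### §0 The leaf on A1 from the crux, seam G-a discharged (route-independent kernel + two Literature theorems) -/

/-- **`BSD(E,3)` on A1 from the deciding crux** — the HL kernel `Koly.bsdp_three_onA1_of_kolyvaginFramesHL`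
(zhang3-p1 p424749) with its seam `hKD` (a conductor-`1` Kolyvagin–Heegner datum on every admissible frame)
fed by Gross 1991 §3 as Literature THEOREMS (`phi_heegnerPointOfConductor_mem_range_map_ringClassField_holds`,
`exists_generator_ringClassGalOver_holds`, through koly's `kolyvaginRoadThree_towerData_of_grossCM` at level
`1`); same term as `bsdp_onA1_of_zhangSharpFrameAtThreeHL` (CruxIffLeaf) but importing only route-independent
kernels. CONDITIONAL on the published binders and the crux; nothing booked.
[cite: WZhang2014, Thm. 1.1 and Remark 5] [cite: McCallumLMS1991, §5 Cor. 5.6] [cite: GrossLMS1991, §3 (p. 238)] -/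
theorem bsdp_three_onA1_of_zhangSharpFrameAtThreeHL_byName
    (hGZ : ∀ (N : ℕ) [NeZero N] (W : WeierstrassCurve ℚ) (K : Type) [Field K] [NumberField K],
      gross_zagier N W K)
    (hKo : ∀ (N : ℕ) [NeZero N] (W : WeierstrassCurve ℚ) (K : Type) [Field K] [NumberField K],
      kolyvagin N W K)
    (hB : ∀ (N : ℕ) [NeZero N] (W : WeierstrassCurve ℚ) (K : Type) [Field K] [NumberField K],
      Kolyvagin1990_padicValNat_card_sha_le N W K)
    (hSk : Skinner2016.thmC_padicValRat_bsd_rank_zero)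
    (hGZK : rank_eq_analyticRank_of_analyticRank_le_one) (hmod : hasEntireLFunction_rat)
    (hnf : exists_isNewformOf) (hHL : HoffsteinLuo1997_exists_twist_L_one_ne_zero)
    (hMaz : mazur_not_dvd_maninConstant_of_odd)
    (hrec : ∀ (N : ℕ) [NeZero N] (W : WeierstrassCurve ℚ) (K : Type) [Field K] [NumberField K],
      heegnerPointOfConductor_one_galoisConj N W K)
    (hMc : McCallum1991_pow_dvd_card_sha_primary_of_certificate)
    (hZ : ZhangSharpFrameAtThreeHL) :
    ∀ (W : WeierstrassCurve ℚ) [W.IsElliptic] [W.IsGloballyMinimal],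
      ClassX11b W 3 → Ram W 3 → ¬ 3 ∣ W.tamagawaProduct → BSDp W 3 :=
  fun W _ _ hX hram htam ↦
    bsdp_three_onA1_of_kolyvaginFramesHL hGZ hKo hB hSk hGZK hmod hnf hHL hMaz hrec hMc
      (fun W _ _ _ K _ _ Dt β ι hK hH hβ ↦
        Summit.BirchSwinnertonDyer.BirchSwinnertonDyer.Theorems.kolyvaginRoadThree_towerData_of_grossCM
          (fun N _ W K _ _ ↦ phi_heegnerPointOfConductor_mem_range_map_ringClassField_holds N W K)
          (fun _ _ _ ↦ exists_generator_ringClassGalOver_holds) W K Dt β ι 1 hK hH hβ squarefree_one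
          (by simp))
      hZ W hX hram htam

/-! ### §1 The census's missing input at `3` (Thm. A′ read at `p = 3`) on the Tamagawa-unit locus -/

/-- **KOLY crux ⟹ `X11Three.MissingInputAt` on X11b@3 ∧ `3 ∤ ∏c`.** For every globally minimal `E/ℚ`
with `(E,3) ∈` X11b (`r_an = 1`, `3 ∥ N`, `E[3]` irreducible) and `3 ∤ ∏_ℓ c_ℓ(E)`: the typed missing
input `X11Three.MissingInputAt W` (`X11.AprimeLocusAt W 3 → PPart W 3`, Castella's A′ read at `3`) follows
from the deciding crux `ZhangSharpFrameAtThreeHL` and the route's published inputs — the A′-locus gives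
a (ram) witness (`X11.ram_of_aprimeLocusAt`), so the pair is on A1, where the crux gives `BSD(E,3)`
(§0: McCallum's structure theorem on one Hoffstein–Luo frame), and
`BSD(E,3)` is the print shape in rank `≤ 1` (`pPart_of_bsdp`). CONDITIONAL on every binder; nothing
booked. [cite: WZhang2014, Thm. 1.1 and Remark 5] [cite: McCallumLMS1991, §5 Cor. 5.6]
[cite: Castella2018Erratum, Thm. A′ (p. 1) with "p > 3" read as "p = 3" (shape only; nothing asserted)]
[cite: Miller2011LMS, Def. 1.1] -/
theorem kolyvaginRoadThree_x11ThreeMissingInputAt_onTam_of_zhangSharpFrameAtThreeHL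
    (hGZ : ∀ (N : ℕ) [NeZero N] (W : WeierstrassCurve ℚ) (K : Type) [Field K] [NumberField K],
      gross_zagier N W K)
    (hKo : ∀ (N : ℕ) [NeZero N] (W : WeierstrassCurve ℚ) (K : Type) [Field K] [NumberField K],
      kolyvagin N W K)
    (hB : ∀ (N : ℕ) [NeZero N] (W : WeierstrassCurve ℚ) (K : Type) [Field K] [NumberField K],
      Kolyvagin1990_padicValNat_card_sha_le N W K)
    (hSk : Skinner2016.thmC_padicValRat_bsd_rank_zero)
    (hGZK : rank_eq_analyticRank_of_analyticRank_le_one) (hmod : hasEntireLFunction_rat)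
    (hnf : exists_isNewformOf) (hHL : HoffsteinLuo1997_exists_twist_L_one_ne_zero)
    (hMaz : mazur_not_dvd_maninConstant_of_odd)
    (hrec : ∀ (N : ℕ) [NeZero N] (W : WeierstrassCurve ℚ) (K : Type) [Field K] [NumberField K],
      heegnerPointOfConductor_one_galoisConj N W K)
    (hMc : McCallum1991_pow_dvd_card_sha_primary_of_certificate)
    (hZ : ZhangSharpFrameAtThreeHL) :
    ∀ (W : WeierstrassCurve ℚ) [W.IsElliptic] [W.IsGloballyMinimal],
      ClassX11b W 3 → ¬ 3 ∣ W.tamagawaProduct → X11Three.MissingInputAt W := by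
  intro W _ _ hX htam hA
  exact pPart_of_bsdp hmod hGZK W 3 (le_of_eq hX.1)
    (bsdp_three_onA1_of_zhangSharpFrameAtThreeHL_byName hGZ hKo hB hSk hGZK hmod hnf hHL hMaz hrec hMc hZ W hX
      (X11.ram_of_aprimeLocusAt hA) htam)

/-! ### §2 THE open input at `3` on A1 ∩ locally-trivial -/

/-- **KOLY crux ⟹ `P2OpenInputOnTreeOddAt W 3` on A1 ∩ `LocallyTrivialAt W 3`.** For every globally
minimal `E/ℚ` with `(E,3) ∈` X11b, a (ram) witness, `3 ∤ ∏_ℓ c_ℓ(E)` and every bad `ℓ ≠ 3` locally trivial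
(`E(ℚ_ℓ)[3] = 0`, `3 ∤ c_ℓ`): THE open input of route p2 at `3` (the (IMC≥)∘(BDP) inequality at `𝟙` on
every odd Manin-good Heegner datum, `X11b.P2OpenInputOnTreeOddAt W 3`) follows from the deciding crux —
`BSD(E,3)` on A1 by §0, then x11b3's tightness theorem
`P2.openInputOnTreeOddAt_of_bsdp_of_locallyTrivial` (the control identity at `3` is a tree theorem on the
locally-trivial class modulo the cited Poitou–Tate ∕ Euler-characteristic ∕ `cd ≤ 2` facts `hEP hPTs hPT2
hcd`). CONDITIONAL on every binder; nothing booked; off `LocallyTrivialAt` nothing is claimed.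
[cite: WZhang2014, Thm. 1.1] [cite: Castella2018, Thm. 2.3 (p. 5), Thm. 3.2 (p. 9)]
[cite: JetchevSkinnerWan2017, Thm. 3.3.1 (p. 11), §7.4.1 (pp. 30–31)] [cite: Miller2011LMS, Def. 1.1] -/
theorem kolyvaginRoadThree_openInputOnTreeOddAt_three_of_zhangSharpFrameAtThreeHL
    (hGZ : ∀ (N : ℕ) [NeZero N] (W : WeierstrassCurve ℚ) (K : Type) [Field K] [NumberField K],
      gross_zagier N W K)
    (hKo : ∀ (N : ℕ) [NeZero N] (W : WeierstrassCurve ℚ) (K : Type) [Field K] [NumberField K],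
      kolyvagin N W K)
    (hB : ∀ (N : ℕ) [NeZero N] (W : WeierstrassCurve ℚ) (K : Type) [Field K] [NumberField K],
      Kolyvagin1990_padicValNat_card_sha_le N W K)
    (hSk : Skinner2016.thmC_padicValRat_bsd_rank_zero)
    (hGZK : rank_eq_analyticRank_of_analyticRank_le_one) (hmod : hasEntireLFunction_rat)
    (hnf : exists_isNewformOf) (hHL : HoffsteinLuo1997_exists_twist_L_one_ne_zero)
    (hMaz : mazur_not_dvd_maninConstant_of_odd)
    (hrec : ∀ (N : ℕ) [NeZero N] (W : WeierstrassCurve ℚ) (K : Type) [Field K] [NumberField K],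
      heegnerPointOfConductor_one_galoisConj N W K)
    (hMc : McCallum1991_pow_dvd_card_sha_primary_of_certificate)
    -- cited cohomological facts feeding the control identity at `3` on the locally-trivial class
    (hEP : ∀ (K : Type) [Field K] [NumberField K] (v : HeightOneSpectrum (𝓞 K)),
      localEulerPoincareCharacteristic (v.adicCompletion K))
    (hPTs : ∀ (K : Type) [Field K] [NumberField K], poitouTate_selmerStructure_duality K)
    (hPT2 : ∀ (K : Type) [Field K] [NumberField K], poitouTate_sha_tateDual K)
    (hcd : fieldCdLE_two_of_numberField)
    (hZ : ZhangSharpFrameAtThreeHL) :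
    ∀ (W : WeierstrassCurve ℚ) [W.IsElliptic] [W.IsGloballyMinimal],
      ClassX11b W 3 → Ram W 3 → ¬ 3 ∣ W.tamagawaProduct → LocallyTrivialAt W 3 →
      P2OpenInputOnTreeOddAt W 3 := by
  intro W _ _ hX hram htam hLT
  exact P2.openInputOnTreeOddAt_of_bsdp_of_locallyTrivial W 3 hGZ hKo hSk hGZK hmod hEP hPTs hPT2 hcd hX
    hram htam hLT
    (bsdp_three_onA1_of_zhangSharpFrameAtThreeHL_byName hGZ hKo hB hSk hGZK hmod hnf hHL hMaz hrec hMc hZ W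
      hX hram htam)

/-! ### §3 THE open input at `3` on ALL of A1 (session g2): the control identity is a tree theorem on the whole Locus -/

/-- **KOLY crux ⟹ `P2OpenInputOnTreeOddAt W 3` on ALL of atom A1 (X11b@3 ∧ (ram) ∧ `3 ∤ ∏_ℓ c_ℓ(E)`;
1 116 TRUE-OPEN classes, cw 248 943 class-pairs `N < 5·10⁵`).** For every globally minimal `E/ℚ` with
`(E,3) ∈` X11b, a (ram) witness and `3 ∤ ∏_ℓ c_ℓ(E)`: THE open input of route p2 at `3` (the
(IMC≥)∘(BDP) inequality at `𝟙` on every odd Manin-good Heegner datum) follows from the deciding crux —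
`BSD(E,3)` on A1 by §0, then x11b3's tightness theorem on the WHOLE Locus with the control identity
DISCHARGED (`P2.openInputOnTreeOddAt_of_bsdp_of_locus_of_facts`: Castella 2018 Thm. 2.3 ∕ JSW 2017
Thm. 3.3.1 re-proved on the constructed `X_ac` at every odd `p` from Kolyvagin and the cited local Euler
characteristic ∕ Poitou–Tate ×2 facts `hEP hPTs hPT2`; `cd_p ≤ 2` and Shimura reciprocity at conductor `1`
are tree THEOREMS and are supplied here). Supersedes §2's locally-trivial restriction. CONDITIONAL on every
binder; item 19574 NOT closed; nothing booked. [cite: WZhang2014, Thm. 1.1 and Remark 5]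
[cite: McCallumLMS1991, §5 Cor. 5.6] [cite: Castella2018, Thm. 2.3 (p. 5), Thm. 3.2 (p. 9)]
[cite: JetchevSkinnerWan2017, §2 (p. 6 L9 "p ≥ 3"), Thm. 3.3.1 (p. 11), §7.4.1 (pp. 30–31)]
[cite: Miller2011LMS, Def. 1.1] -/
theorem kolyvaginRoadThree_openInputOnTreeOddAt_three_onA1_of_zhangSharpFrameAtThreeHL
    (hGZ : ∀ (N : ℕ) [NeZero N] (W : WeierstrassCurve ℚ) (K : Type) [Field K] [NumberField K],
      gross_zagier N W K)
    (hKo : ∀ (N : ℕ) [NeZero N] (W : WeierstrassCurve ℚ) (K : Type) [Field K] [NumberField K],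
      kolyvagin N W K)
    (hB : ∀ (N : ℕ) [NeZero N] (W : WeierstrassCurve ℚ) (K : Type) [Field K] [NumberField K],
      Kolyvagin1990_padicValNat_card_sha_le N W K)
    (hSk : Skinner2016.thmC_padicValRat_bsd_rank_zero)
    (hGZK : rank_eq_analyticRank_of_analyticRank_le_one) (hmod : hasEntireLFunction_rat)
    (hnf : exists_isNewformOf) (hHL : HoffsteinLuo1997_exists_twist_L_one_ne_zero)
    (hMaz : mazur_not_dvd_maninConstant_of_odd)
    (hMc : McCallum1991_pow_dvd_card_sha_primary_of_certificate)
    -- cited cohomological facts feeding the control identity on the whole Locus (x11b3 `ControlIdentityLocus`)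
    (hEP : ∀ (K : Type) [Field K] [NumberField K] (v : HeightOneSpectrum (𝓞 K)),
      localEulerPoincareCharacteristic (v.adicCompletion K))
    (hPTs : ∀ (K : Type) [Field K] [NumberField K], poitouTate_selmerStructure_duality K)
    (hPT2 : ∀ (K : Type) [Field K] [NumberField K], poitouTate_sha_tateDual K)
    (hZ : ZhangSharpFrameAtThreeHL) :
    ∀ (W : WeierstrassCurve ℚ) [W.IsElliptic] [W.IsGloballyMinimal],
      ClassX11b W 3 → Ram W 3 → ¬ 3 ∣ W.tamagawaProduct → P2OpenInputOnTreeOddAt W 3 := by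
  intro W _ _ hX hram htam
  exact P2.openInputOnTreeOddAt_of_bsdp_of_locus_of_facts W 3 hGZ hKo hSk hGZK hmod hEP hPTs hPT2
    Literature.NumberTheory.GaloisRepresentations.fieldCdLE_two_of_numberField_holds hX hram htam
    (bsdp_three_onA1_of_zhangSharpFrameAtThreeHL_byName hGZ hKo hB hSk hGZK hmod hnf hHL hMaz
      (fun N _ W K _ _ ↦ heegnerPointOfConductor_one_galoisConj_holds N W K) hMc hZ W hX hram htam)

/-- **KOLY crux ⟹ x11b3-p1's typed STEP-L-at-3 conjecture `Three.StepLAt W` on ALL of A1** — §3 read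
through `stepLAt_of_p2OpenInputOnTreeOddAt` (`Three/StepLAtThree`: `StepLAt W ↔ P2OpenInputOnTreeOddAt W 3`,
the binders `3 ∤ d_K`, `3 ∤ #𝓞_K^×` being automatic at a Heegner field for `3 ∣ N`). Same inputs as §3.
CONDITIONAL; nothing booked. [cite: WZhang2014, Thm. 1.1] [cite: McCallumLMS1991, §5 Cor. 5.6]
[cite: Castella2018, Thm. 2.3 (p. 5), Thm. 3.2 (p. 9)] [cite: JetchevSkinnerWan2017, Thm. 3.3.1 (p. 11)] -/
theorem kolyvaginRoadThree_stepLAt_onA1_of_zhangSharpFrameAtThreeHL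
    (hGZ : ∀ (N : ℕ) [NeZero N] (W : WeierstrassCurve ℚ) (K : Type) [Field K] [NumberField K],
      gross_zagier N W K)
    (hKo : ∀ (N : ℕ) [NeZero N] (W : WeierstrassCurve ℚ) (K : Type) [Field K] [NumberField K],
      kolyvagin N W K)
    (hB : ∀ (N : ℕ) [NeZero N] (W : WeierstrassCurve ℚ) (K : Type) [Field K] [NumberField K],
      Kolyvagin1990_padicValNat_card_sha_le N W K)
    (hSk : Skinner2016.thmC_padicValRat_bsd_rank_zero)
    (hGZK : rank_eq_analyticRank_of_analyticRank_le_one) (hmod : hasEntireLFunction_rat)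
    (hnf : exists_isNewformOf) (hHL : HoffsteinLuo1997_exists_twist_L_one_ne_zero)
    (hMaz : mazur_not_dvd_maninConstant_of_odd)
    (hMc : McCallum1991_pow_dvd_card_sha_primary_of_certificate)
    (hEP : ∀ (K : Type) [Field K] [NumberField K] (v : HeightOneSpectrum (𝓞 K)),
      localEulerPoincareCharacteristic (v.adicCompletion K))
    (hPTs : ∀ (K : Type) [Field K] [NumberField K], poitouTate_selmerStructure_duality K)
    (hPT2 : ∀ (K : Type) [Field K] [NumberField K], poitouTate_sha_tateDual K)
    (hZ : ZhangSharpFrameAtThreeHL) :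
    ∀ (W : WeierstrassCurve ℚ) [W.IsElliptic] [W.IsGloballyMinimal],
      ClassX11b W 3 → Ram W 3 → ¬ 3 ∣ W.tamagawaProduct → StepLAt W :=
  fun W _ _ hX hram htam ↦ stepLAt_of_p2OpenInputOnTreeOddAt
    (kolyvaginRoadThree_openInputOnTreeOddAt_three_onA1_of_zhangSharpFrameAtThreeHL hGZ hKo hB hSk hGZK hmod
      hnf hHL hMaz hMc hEP hPTs hPT2 hZ W hX hram htam)

/-! ### §4 The leaf and the missing input on A1 with Shimura reciprocity SUPPLIED (session g2) -/

/-- **`BSD(E,3)` on A1 from the deciding crux, `hrec` discharged** — §0 with the Shimura-reciprocity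
binder at conductor `1` (Darmon 2004 Thm. 3.7 ∕ Gross 1991 §4) supplied by the tree theorem
`heegnerPointOfConductor_one_galoisConj_holds` (`HeegnerPointsOfConductorOneGaloisConjProofs`, 2026-08-27).
Remaining binders: the published named facts (Gross–Zagier, Kolyvagin ×2, Skinner Thm. C, GZK, modularity
×2, Hoffstein–Luo, Mazur, McCallum Cor. 5.6) and the crux. CONDITIONAL; nothing booked.
[cite: WZhang2014, Thm. 1.1 and Remark 5] [cite: McCallumLMS1991, §5 Cor. 5.6] [cite: Darmon2004, Thm. 3.7] -/
theorem bsdp_three_onA1_of_zhangSharpFrameAtThreeHL_byName'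
    (hGZ : ∀ (N : ℕ) [NeZero N] (W : WeierstrassCurve ℚ) (K : Type) [Field K] [NumberField K],
      gross_zagier N W K)
    (hKo : ∀ (N : ℕ) [NeZero N] (W : WeierstrassCurve ℚ) (K : Type) [Field K] [NumberField K],
      kolyvagin N W K)
    (hB : ∀ (N : ℕ) [NeZero N] (W : WeierstrassCurve ℚ) (K : Type) [Field K] [NumberField K],
      Kolyvagin1990_padicValNat_card_sha_le N W K)
    (hSk : Skinner2016.thmC_padicValRat_bsd_rank_zero)
    (hGZK : rank_eq_analyticRank_of_analyticRank_le_one) (hmod : hasEntireLFunction_rat)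
    (hnf : exists_isNewformOf) (hHL : HoffsteinLuo1997_exists_twist_L_one_ne_zero)
    (hMaz : mazur_not_dvd_maninConstant_of_odd)
    (hMc : McCallum1991_pow_dvd_card_sha_primary_of_certificate)
    (hZ : ZhangSharpFrameAtThreeHL) :
    ∀ (W : WeierstrassCurve ℚ) [W.IsElliptic] [W.IsGloballyMinimal],
      ClassX11b W 3 → Ram W 3 → ¬ 3 ∣ W.tamagawaProduct → BSDp W 3 :=
  bsdp_three_onA1_of_zhangSharpFrameAtThreeHL_byName hGZ hKo hB hSk hGZK hmod hnf hHL hMaz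
    (fun N _ W K _ _ ↦ heegnerPointOfConductor_one_galoisConj_holds N W K) hMc hZ

/-- **KOLY crux ⟹ `X11Three.MissingInputAt` on X11b@3 ∧ `3 ∤ ∏c`, `hrec` discharged** — §1 with Shimura
reciprocity supplied by `heegnerPointOfConductor_one_galoisConj_holds`. CONDITIONAL; nothing booked.
[cite: WZhang2014, Thm. 1.1] [cite: McCallumLMS1991, §5 Cor. 5.6]
[cite: Castella2018Erratum, Thm. A′ (p. 1) with "p > 3" read as "p = 3" (shape only; nothing asserted)] -/
theorem kolyvaginRoadThree_x11ThreeMissingInputAt_onTam_of_zhangSharpFrameAtThreeHL'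
    (hGZ : ∀ (N : ℕ) [NeZero N] (W : WeierstrassCurve ℚ) (K : Type) [Field K] [NumberField K],
      gross_zagier N W K)
    (hKo : ∀ (N : ℕ) [NeZero N] (W : WeierstrassCurve ℚ) (K : Type) [Field K] [NumberField K],
      kolyvagin N W K)
    (hB : ∀ (N : ℕ) [NeZero N] (W : WeierstrassCurve ℚ) (K : Type) [Field K] [NumberField K],
      Kolyvagin1990_padicValNat_card_sha_le N W K)
    (hSk : Skinner2016.thmC_padicValRat_bsd_rank_zero)
    (hGZK : rank_eq_analyticRank_of_analyticRank_le_one) (hmod : hasEntireLFunction_rat)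
    (hnf : exists_isNewformOf) (hHL : HoffsteinLuo1997_exists_twist_L_one_ne_zero)
    (hMaz : mazur_not_dvd_maninConstant_of_odd)
    (hMc : McCallum1991_pow_dvd_card_sha_primary_of_certificate)
    (hZ : ZhangSharpFrameAtThreeHL) :
    ∀ (W : WeierstrassCurve ℚ) [W.IsElliptic] [W.IsGloballyMinimal],
      ClassX11b W 3 → ¬ 3 ∣ W.tamagawaProduct → X11Three.MissingInputAt W :=
  kolyvaginRoadThree_x11ThreeMissingInputAt_onTam_of_zhangSharpFrameAtThreeHL hGZ hKo hB hSk hGZK hmod hnf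
    hHL hMaz (fun N _ W K _ _ ↦ heegnerPointOfConductor_one_galoisConj_holds N W K) hMc hZ

end Summit.BirchSwinnertonDyer.Rank1Residual.X11b.Three.Koly

end
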